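import Summits.CriticalPhenomena.SAWScalingLimit.Theorems.SAWDevelopingMapObservableToSLERestrictionCocycleHelpersReflection
import Summits.CriticalPhenomena.SAWScalingLimit.Theorems.SAWDevelopingMapObservableToSLERestrictionCocycleHelpersCoalescence
import Literature.Probability.RandomPlanarGeometry.ConformalMapRiemannProofs
import Literature.Probability.RandomPlanarGeometry.RestrictionHullsProofs
import HarnessLib

/-!
# Crux `SAWDevelopingMap.ObservableToSLE` (stmt-CriticalPhenomena-10472), line
`floor-ratio-restriction-bootstrap`: the conformal package of the mechanism stub
`stub_restrictionCocycle`

Landing target: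
`Summits/CriticalPhenomena/SAWScalingLimit/Theorems/SAWDevelopingMapObservableToSLERestrictionCocycleHelpersPackage.lean`
(`--supports stmt-CriticalPhenomena-10472`).

For a floor-type Dobrushin domain `(D; a, b)` (flat half-discs of radius `ρ` at both marked points,
`im a = im b`), a hull subdomain `D'`, a chordal uniformizing map `φ` of `D` and the restriction map
`Φ_A` of the pulled-back hull with `Φ_A'(0) = d`, `exists_conformalPackage` produces ALL the
conformal data consumed by the two target transports of the bootstrap: the half-plane maps
`Ψ = -1/φ⁻¹ : D → ℍ`, `Ψ' = -1/(Φ_A ∘ φ⁻¹) : D' → ℍ` (normalised `a ↦ ∞`, `b ↦ 0`), continuous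
logarithms `L, L'` of their derivatives with boundary limits `Lb, L'b` at `b` and `Ls, L's` at every
floor point `s = a + t`, `0 < t < ρ₁`, together with the modulus function
`R(t) = exp((5/8)(Re(Ls - Lb) - Re(L's - L'b)))` and its COALESCENCE `R(t) → d^{5/8}` as `t → 0⁺`
(`R(t) = |N(q_t)|^{-5/8}`, `N = E' w²/E²`, `q_t = φ⁻¹(s) → 0`; siblings `…HelpersReflection`,
`…HelpersCoalescence`).
-/

noncomputable section

open scoped Topology Real
open Filter Set Metric Complex Bornology Function
open Literature.Probability.RandomPlanarGeometry
open UpperHalfPlane (upperHalfPlaneSet isOpen_upperHalfPlaneSet)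

namespace Summit.CriticalPhenomena.SAWScalingLimit.Theorems.ObservableToSLE.FloorRatio

/-! ### Flat boundary points -/

/-- Flatness is inherited by smaller half-discs on the same floor line: if `S ∩ B(x, ρ)` is the upper
half-disc and `B(y, r) ⊆ B(x, ρ)` with `im y = im x`, then `S ∩ B(y, r)` is the upper half-disc.
[folklore] -/
theorem flat_of_subset {S : Set ℂ} {x y : ℂ} {ρ r : ℝ}
    (hflat : S ∩ ball x ρ = {z : ℂ | x.im < z.im} ∩ ball x ρ) (hsub : ball y r ⊆ ball x ρ)
    (hy : y.im = x.im) : S ∩ ball y r = {z : ℂ | y.im < z.im} ∩ ball y r := by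
  ext z
  constructor
  · rintro ⟨hzS, hzr⟩
    have hz : z ∈ S ∩ ball x ρ := ⟨hzS, hsub hzr⟩
    rw [hflat] at hz
    exact ⟨by rw [hy]; exact hz.1, hzr⟩
  · rintro ⟨hz1, hzr⟩
    have hz : z ∈ {z : ℂ | x.im < z.im} ∩ ball x ρ := ⟨by rw [← hy]; exact hz1, hsub hzr⟩
    rw [← hflat] at hz
    exact ⟨hz.1, hzr⟩

/-- A point of the diameter of a flat half-disc is a frontier point: `x + t ∈ ∂S` for `|t| < ρ` if
`S ∩ B(x, ρ) = {im > im x} ∩ B(x, ρ)`. [folklore] -/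
theorem mem_frontier_of_flat {S : Set ℂ} {x : ℂ} {ρ : ℝ}
    (hflat : S ∩ ball x ρ = {z : ℂ | x.im < z.im} ∩ ball x ρ) {t : ℝ} (ht : |t| < ρ) :
    x + t ∈ frontier S := by
  rw [frontier_eq_closure_inter_closure]
  refine ⟨?_, subset_closure ?_⟩
  · -- `x + t + iε → x + t` with `x + t + iε ∈ S` for small `ε > 0`
    have hpath : Tendsto (fun ε : ℝ ↦ x + t + I * ε) (𝓝[>] 0) (𝓝 (x + t)) := by
      have : Continuous fun ε : ℝ ↦ x + t + I * ε := by fun_prop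
      simpa using (this.tendsto 0).mono_left nhdsWithin_le_nhds
    refine mem_closure_of_tendsto hpath ?_
    have hev : ∀ᶠ ε : ℝ in 𝓝[>] 0, ε < ρ - |t| :=
      mem_nhdsWithin_of_mem_nhds (Iio_mem_nhds (by linarith))
    filter_upwards [hev, self_mem_nhdsWithin] with ε hε hε0
    have hε0' : 0 < ε := hε0
    have hz : x + t + I * ε ∈ {z : ℂ | x.im < z.im} ∩ ball x ρ := by
      refine ⟨?_, ?_⟩
      · show x.im < (x + t + I * ε).im
        simp [hε0']
      · rw [mem_ball, dist_eq_norm, show x + ↑t + I * ↑ε - x = t + I * ε by ring]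
        calc ‖(t : ℂ) + I * ε‖ ≤ ‖(t : ℂ)‖ + ‖I * (ε : ℂ)‖ := norm_add_le _ _
          _ = |t| + ε := by
              rw [norm_real, Real.norm_eq_abs, norm_mul, norm_I, one_mul, norm_real,
                Real.norm_of_nonneg hε0'.le]
          _ < ρ := by linarith
    rw [← hflat] at hz
    exact hz.1
  · intro h
    have hz : x + t ∈ S ∩ ball x ρ := by
      refine ⟨h, ?_⟩
      rw [mem_ball, dist_eq_norm, add_sub_cancel_left, norm_real, Real.norm_eq_abs]
      exact ht
    rw [hflat] at hz
    have : x.im < (x + (t : ℂ)).im := hz.1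
    simp at this

/-! ### The conformal package -/

/-- **The conformal package of the bootstrap.**  See the module docstring: half-plane maps
`Ψ : D → ℍ`, `Ψ' : D' → ℍ` with `a ↦ ∞`, `b ↦ 0`, continuous logarithms `L, L'` of `Ψ', Ψ''`
with boundary limits at `b` and at the floor points `a + t` (`0 < t < ρ₁`), flatness of `D'` at
`a, b` with radius `ρ₁`, and the coalescence `R(t) → d^{5/8}` of the modulus function
`R(t) = exp((5/8)(Re(Ls - Lb) - Re(L's - L'b)))`.
[cite: LawlerSchrammWerner2003Restriction, §2 (2.4) p. 7 and §2 p. 9, transposed] -/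
theorem exists_conformalPackage (D D' : DobrushinDomain) (ρ : ℝ)
    (φ : ConformalEquiv upperHalfPlaneSet D.carrier)
    (Φ : ConformalEquiv (upperHalfPlaneSet \ φ.pullbackHull D') upperHalfPlaneSet) (d : ℝ)
    (hρ : 0 < ρ)
    (hflat0 : D.carrier ∩ ball (D.pt 0) ρ = {z : ℂ | (D.pt 0).im < z.im} ∩ ball (D.pt 0) ρ)
    (hflat1 : D.carrier ∩ ball (D.pt 1) ρ = {z : ℂ | (D.pt 1).im < z.im} ∩ ball (D.pt 1) ρ)
    (hD' : D.IsHullSubdomain D') (hφ : D.IsChordalUniformizing φ)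
    (hΦ : IsRestrictionMap (φ.pullbackHull D') Φ)
    (hd : HasRestrictionDeriv (φ.pullbackHull D') Φ d) :
    ∃ (Ψ : ConformalEquiv D.carrier upperHalfPlaneSet) (L : ℂ → ℂ) (Lb : ℂ)
      (Ψ' : ConformalEquiv D'.carrier upperHalfPlaneSet) (L' : ℂ → ℂ) (L'b : ℂ) (ρ₁ : ℝ)
      (R : ℝ → ℝ), 0 < ρ₁ ∧ ρ₁ ≤ ρ ∧
      Tendsto (fun z => ‖Ψ z‖) (𝓝[D.carrier] (D.pt 0)) atTop ∧ Ψ.HasBoundaryValue (D.pt 1) 0 ∧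
      ContinuousOn L D.carrier ∧ (∀ z ∈ D.carrier, exp (L z) = deriv Ψ z) ∧
      Tendsto L (𝓝[D.carrier] (D.pt 1)) (𝓝 Lb) ∧
      Tendsto (fun z => ‖Ψ' z‖) (𝓝[D'.carrier] (D.pt 0)) atTop ∧ Ψ'.HasBoundaryValue (D.pt 1) 0 ∧
      ContinuousOn L' D'.carrier ∧ (∀ z ∈ D'.carrier, exp (L' z) = deriv Ψ' z) ∧
      Tendsto L' (𝓝[D'.carrier] (D.pt 1)) (𝓝 L'b) ∧
      D'.carrier ∩ ball (D.pt 0) ρ₁ = {z : ℂ | (D.pt 0).im < z.im} ∩ ball (D.pt 0) ρ₁ ∧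
      D'.carrier ∩ ball (D.pt 1) ρ₁ = {z : ℂ | (D.pt 1).im < z.im} ∩ ball (D.pt 1) ρ₁ ∧
      (∀ t : ℝ, 0 < t → t < ρ₁ →
        (D.pt 0 + t ∈ frontier D.carrier) ∧ (D.pt 0 + t ∈ frontier D'.carrier) ∧
        (D.pt 0 + (t : ℂ) ≠ D.pt 0) ∧
        ∃ Ls L's : ℂ, Tendsto L (𝓝[D.carrier] (D.pt 0 + t)) (𝓝 Ls) ∧
          Tendsto L' (𝓝[D'.carrier] (D.pt 0 + t)) (𝓝 L's) ∧
          Real.exp ((5 / 8) * ((Ls - Lb).re - (L's - L'b).re)) = R t) ∧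
      Tendsto R (𝓝[>] 0) (𝓝 (d ^ ((5 : ℝ) / 8))) := by
  -- names
  set a₀ : ℂ := D.pt 0 with ha₀
  set b₀ : ℂ := D.pt 1 with hb₀
  have hab : a₀ ≠ b₀ := fun h => absurd (D.pt_injective h) (by decide)
  have hdab : 0 < dist a₀ b₀ := dist_pos.2 hab
  have hsub : D'.carrier ⊆ D.carrier := hD'.carrier_subset
  -- the hull and its reflected restriction map
  have hA : IsStarHull (φ.pullbackHull D') :=
    IsStarHull.pullbackHull JordanDomain.isSimplyConnected_holds hφ hD'
  have hB : IsBoundedHull (φ.pullbackHull D') := hA.isBoundedHull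
  have hd0 : 0 < d := by
    obtain ⟨d', hd'0, -, hd'⟩ := IsStarHull.exists_hasRestrictionDeriv_holds hA hΦ
    rwa [HasRestrictionDeriv.unique hA hd hd']
  -- the half-plane maps and the logarithms
  obtain ⟨Ψ, hΨ, hΨinf, hΨb, hΨreal⟩ := exists_halfPlaneMap D φ hφ
  obtain ⟨L, hLc, hLe⟩ := exists_log_deriv D.toJordanDomain Ψ
  set φ' : ConformalEquiv upperHalfPlaneSet D'.carrier := Φ.symm.trans (φ.restrHull D' hsub) with hφ'
  have hφ'u : D'.IsChordalUniformizing φ' :=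
    MarkedDomain.IsChordalUniformizing.pullback JordanDomain.isSimplyConnected_holds
      exists_conformalEquiv_ball_holds JordanDomain.exists_continuousOn_extension_holds hφ hD' hΦ
  obtain ⟨Ψ', hΨ'₀, hΨ'inf, hΨ'b, hΨ'real⟩ := exists_halfPlaneMap D' φ' hφ'u
  have hΨ' : ∀ z, Ψ' z = -(Φ (φ.symm z))⁻¹ := fun z => by rw [hΨ'₀ z]; rfl
  obtain ⟨L', hL'c, hL'e⟩ := exists_log_deriv D'.toJordanDomain Ψ'
  rw [hD'.pt_zero_eq, ← ha₀] at hΨ'inf hΨ'real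
  rw [hD'.pt_one_eq, ← hb₀] at hΨ'b
  rw [← ha₀] at hΨinf hΨreal
  rw [← hb₀] at hΨb
  -- radii: `D' = D` near `a₀` and `b₀`
  have hagree : ∀ p : ℂ, p ∉ closure (D.carrier \ D'.carrier) →
      ∃ r > 0, ∀ r' ≤ r, D'.carrier ∩ ball p r' = D.carrier ∩ ball p r' := by
    intro p hp
    obtain ⟨r, hr, hrs⟩ := Metric.mem_nhds_iff.1 (isClosed_closure.isOpen_compl.mem_nhds hp)
    refine ⟨r, hr, fun r' hr' => Set.ext fun z => ⟨fun h => ⟨hsub h.1, h.2⟩, fun h => ⟨?_, h.2⟩⟩⟩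
    by_contra h'
    exact hrs (ball_subset_ball hr' h.2) (subset_closure ⟨h.1, h'⟩)
  obtain ⟨ra, hra, hraD⟩ := hagree a₀ hD'.pt_zero_notMem
  obtain ⟨rb, hrb, hrbD⟩ := hagree b₀ hD'.pt_one_notMem
  -- `ρ₀`: the geometric radius
  set ρ₀ : ℝ := min (min ρ ra) (min rb (dist a₀ b₀)) / 2 with hρ₀
  have hρ₀pos : 0 < ρ₀ := by
    rw [hρ₀]; exact half_pos (lt_min (lt_min hρ hra) (lt_min hrb hdab))
  obtain ⟨hρ₀ρ, hρ₀a, hρ₀b, hρ₀d⟩ : 2 * ρ₀ ≤ ρ ∧ 2 * ρ₀ ≤ ra ∧ 2 * ρ₀ ≤ rb ∧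
      2 * ρ₀ ≤ dist a₀ b₀ := by
    rw [hρ₀]
    refine ⟨?_, ?_, ?_, ?_⟩ <;>
      linarith [min_le_left (min ρ ra) (min rb (dist a₀ b₀)), min_le_left ρ ra, min_le_right ρ ra,
        min_le_right (min ρ ra) (min rb (dist a₀ b₀)), min_le_left rb (dist a₀ b₀),
        min_le_right rb (dist a₀ b₀)]
  -- flatness of `D'` at `a₀` and `b₀` (radius `2ρ₀`)
  have hflat0' : D'.carrier ∩ ball a₀ (2 * ρ₀) = {z : ℂ | a₀.im < z.im} ∩ ball a₀ (2 * ρ₀) := by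
    rw [hraD _ hρ₀a]; exact flat_of_subset hflat0 (ball_subset_ball hρ₀ρ) rfl
  have hflat1' : D'.carrier ∩ ball b₀ (2 * ρ₀) = {z : ℂ | b₀.im < z.im} ∩ ball b₀ (2 * ρ₀) := by
    rw [hrbD _ hρ₀b]; exact flat_of_subset hflat1 (ball_subset_ball hρ₀ρ) rfl
  -- the boundary values `Q t` of `φ⁻¹` at the floor points `a₀ + t`
  have hfr : ∀ t : ℝ, |t| < 2 * ρ₀ → a₀ + t ∈ frontier D.carrier := fun t ht =>
    mem_frontier_of_flat hflat0 (ht.trans_le hρ₀ρ)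
  have hfr' : ∀ t : ℝ, |t| < 2 * ρ₀ → a₀ + t ∈ frontier D'.carrier := fun t ht =>
    mem_frontier_of_flat hflat0' ht
  have hne_a : ∀ t : ℝ, t ≠ 0 → a₀ + (t : ℂ) ≠ a₀ := fun t ht h => ht (by
    have := congrArg Complex.re h; simpa using this)
  have hne_b : ∀ t : ℝ, |t| < 2 * ρ₀ → a₀ + (t : ℂ) ≠ b₀ := by
    intro t ht h
    have : dist a₀ b₀ = |t| := by
      rw [← h, dist_eq_norm, show a₀ - (a₀ + t) = -(t : ℂ) by ring, norm_neg, norm_real,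
        Real.norm_eq_abs]
    linarith
  have hq : ∀ t : ℝ, t ≠ 0 → |t| < 2 * ρ₀ → ∃ q : ℝ, q ≠ 0 ∧
      Tendsto φ.symm (𝓝[D.carrier] (a₀ + t)) (𝓝 (q : ℂ)) := fun t ht0 ht =>
    hφ.exists_tendsto_symm_of_mem_frontier (hfr t ht) (hne_a t ht0) (hne_b t ht)
  set Q : ℝ → ℂ := fun t => extendFrom D.carrier φ.symm (a₀ + t) with hQ
  have hQt : ∀ t : ℝ, t ≠ 0 → |t| < 2 * ρ₀ → ∃ q : ℝ, q ≠ 0 ∧ Q t = q ∧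
      Tendsto φ.symm (𝓝[D.carrier] (a₀ + t)) (𝓝 (q : ℂ)) := by
    intro t ht0 ht
    obtain ⟨q, hq0, hqt⟩ := hq t ht0 ht
    exact ⟨q, hq0, extendFrom_eq (frontier_subset_closure (hfr t ht)) hqt, hqt⟩
  have hQ0 : Tendsto Q (𝓝[>] 0) (𝓝 0) := by
    -- continuity of the extension along the floor segment
    set T : Set ℂ := (fun t : ℝ => a₀ + t) '' Ioo (-(2 * ρ₀)) (2 * ρ₀) with hT
    have hTsub : T ⊆ closure D.carrier := by
      rintro _ ⟨t, ht, rfl⟩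
      exact frontier_subset_closure (hfr t (abs_lt.2 ht))
    have hlim : ∀ z ∈ T, ∃ y, Tendsto φ.symm (𝓝[D.carrier] z) (𝓝 y) := by
      rintro _ ⟨t, ht, rfl⟩
      by_cases ht0 : t = 0
      · subst ht0
        refine ⟨0, ?_⟩
        have := hφ.tendsto_symm_nhds_zero
        simpa [ha₀] using this
      · obtain ⟨q, -, hqt⟩ := hq t ht0 (abs_lt.2 ht)
        exact ⟨q, hqt⟩
    have hcont : ContinuousOn (extendFrom D.carrier φ.symm) T := continuousOn_extendFrom hTsub hlim
    have ha₀T : a₀ ∈ T := ⟨0, by simp [hρ₀pos], by simp⟩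
    have hG0 : extendFrom D.carrier φ.symm a₀ = 0 := by
      refine extendFrom_eq (frontier_subset_closure (D.pt_mem_frontier 0)) ?_
      have := hφ.tendsto_symm_nhds_zero
      simpa [ha₀] using this
    have h1 : Tendsto (extendFrom D.carrier φ.symm) (𝓝[T] a₀) (𝓝 0) := by
      rw [← hG0]; exact hcont a₀ ha₀T
    have h2 : Tendsto (fun t : ℝ => a₀ + t) (𝓝[>] 0) (𝓝[T] a₀) := by
      refine tendsto_nhdsWithin_iff.2 ⟨?_, ?_⟩
      · have : Continuous fun t : ℝ => a₀ + t := by fun_prop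
        simpa using (this.tendsto 0).mono_left nhdsWithin_le_nhds
      · have hev : ∀ᶠ t : ℝ in 𝓝[>] 0, t < 2 * ρ₀ :=
          mem_nhdsWithin_of_mem_nhds (Iio_mem_nhds (by linarith))
        filter_upwards [hev, self_mem_nhdsWithin] with t ht ht0
        have ht0' : (0 : ℝ) < t := ht0
        exact ⟨t, ⟨by linarith, ht⟩, rfl⟩
    exact h1.comp h2
  -- `ε₁`: small nonzero points are good for `N`; `t₀`: for `0 < t < t₀`, `|Q t| < ε₁`
  obtain ⟨ε₁, hε₁, hgood⟩ : ∃ ε₁ > 0, ∀ q : ℂ, q ≠ 0 → ‖q‖ < ε₁ →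
      q ∈ symmDomain (φ.pullbackHull D') ∧ hullExt Φ q ≠ 0 := by
    obtain ⟨ε, hε, hεA⟩ : ∃ ε > 0, ball (0 : ℂ) ε ⊆ (φ.pullbackHull D')ᶜ :=
      Metric.mem_nhds_iff.1 (hB.isClosed.isOpen_compl.mem_nhds hA.zero_notMem)
    have hslope : Tendsto (fun w ↦ hullExt Φ w / w) (𝓝[≠] 0) (𝓝 (d : ℂ)) := by
      refine ((hasDerivAt_iff_tendsto_slope.1 (hasDerivAt_hullExt_zero hA hΦ hd)).congr' ?_)
      filter_upwards [self_mem_nhdsWithin] with w hw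
      rw [slope_def_field, hullExt_zero hA hΦ, sub_zero, sub_zero]
    have hev := hslope.eventually_ne (show (d : ℂ) ≠ 0 by exact_mod_cast hd0.ne')
    rw [eventually_nhdsWithin_iff, Metric.eventually_nhds_iff_ball] at hev
    obtain ⟨ε', hε', hε'E⟩ := hev
    refine ⟨min ε ε', lt_min hε hε', fun q hq0 hq => ⟨?_, fun h => ?_⟩⟩
    · have hdisj : Disjoint (ball ((0 : ℝ) : ℂ) ε) (φ.pullbackHull D') := by
        rw [ofReal_zero]; exact subset_compl_iff_disjoint_right.1 hεA
      exact ball_subset_symmDomain hdisj (by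
        rw [ofReal_zero, mem_ball_zero_iff]; exact hq.trans_le (min_le_left _ _))
    · exact hε'E q (mem_ball_zero_iff.2 (hq.trans_le (min_le_right _ _))) hq0 (by rw [h, zero_div])
  obtain ⟨t₀, ht₀, ht₀Q⟩ : ∃ t₀ > 0, ∀ t : ℝ, 0 < t → t < t₀ → ‖Q t‖ < ε₁ := by
    have hev : ∀ᶠ t in 𝓝[>] (0 : ℝ), ‖Q t‖ < ε₁ := by
      filter_upwards [hQ0 (Metric.ball_mem_nhds 0 hε₁)] with t ht
      simpa using ht
    rw [eventually_nhdsWithin_iff, Metric.eventually_nhds_iff_ball] at hev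
    obtain ⟨t₀, ht₀, h⟩ := hev
    refine ⟨t₀, ht₀, fun t ht ht' => h t ?_ ht⟩
    rw [mem_ball, Real.dist_eq, sub_zero, abs_of_pos ht]; exact ht'
  -- the final radius
  set ρ₁ : ℝ := min ρ₀ t₀ with hρ₁
  have hρ₁pos : 0 < ρ₁ := lt_min hρ₀pos ht₀
  have hρ₁ρ₀ : ρ₁ ≤ ρ₀ := min_le_left _ _
  have hρ₁t₀ : ρ₁ ≤ t₀ := min_le_right _ _
  -- boundary limits at `b₀`
  have hne_b' : ∀ t : ℝ, |t| < ρ₀ → b₀ + (t : ℂ) ≠ a₀ := by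
    intro t ht h
    have : dist a₀ b₀ = |t| := by
      rw [← h, dist_eq_norm, show b₀ + t - b₀ = (t : ℂ) by ring, norm_real, Real.norm_eq_abs]
    linarith
  have hbvb : ∀ t : ℝ, |t| < ρ₀ → ∃ σ : ℝ, Tendsto Ψ (𝓝[D.carrier] (b₀ + t)) (𝓝 (σ : ℂ)) :=
    fun t ht => hΨreal _ (mem_frontier_of_flat hflat1 (by linarith)) (hne_b' t ht)
  have hbvb' : ∀ t : ℝ, |t| < ρ₀ → ∃ σ : ℝ, Tendsto Ψ' (𝓝[D'.carrier] (b₀ + t)) (𝓝 (σ : ℂ)) :=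
    fun t ht => hΨ'real _ (mem_frontier_of_flat hflat1' (by linarith)) (hne_b' t ht)
  obtain ⟨Lb, hLb⟩ := exists_tendsto_log_deriv_of_flat Ψ hρ₀pos
    (flat_of_subset hflat1 (ball_subset_ball (by linarith)) rfl) hbvb hLc hLe
  obtain ⟨L'b, hL'b⟩ := exists_tendsto_log_deriv_of_flat Ψ' hρ₀pos
    (flat_of_subset hflat1' (ball_subset_ball (by linarith)) rfl) hbvb' hL'c hL'e
  -- the key identity `exp (L' - L) = N ∘ φ⁻¹` on `D'`
  have hkey : ∀ z ∈ D'.carrier, exp (L' z - L z) =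
      deriv (hullExt Φ) (φ.symm z) * (φ.symm z) ^ 2 / hullExt Φ (φ.symm z) ^ 2 := by
    intro z hz
    obtain ⟨hne, hder⟩ := deriv_halfPlaneMap_pullback hsub hB hΦ Ψ hΨ Ψ' hΨ' hz
    rw [exp_sub, hL'e z hz, hLe z (hsub hz), hder, mul_div_assoc, div_self hne, mul_one]
  -- `exp (L'b - Lb) = 1`
  have hb1 : exp (L'b - Lb) = 1 := by
    refine exp_sub_eq_of_tendsto hsub (frontier_subset_closure ?_) hLb hL'b ?_ hkey
    · show D.pt 1 ∈ frontier D'.carrier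
      rw [← hD'.pt_one_eq]; exact D'.pt_mem_frontier 1
    · have h1 : Tendsto φ.symm (𝓝[D'.carrier] b₀) (cocompact ℂ) :=
        hφ.tendsto_symm_cocompact.mono_left (nhdsWithin_mono _ hsub)
      exact (tendsto_derivRatio_cocompact hB hΦ).comp h1
  -- the modulus function
  set R : ℝ → ℝ := fun t => Real.exp ((5 / 8) *
    -Real.log ‖deriv (hullExt Φ) (Q t) * (Q t) ^ 2 / hullExt Φ (Q t) ^ 2‖) with hR
  refine ⟨Ψ, L, Lb, Ψ', L', L'b, ρ₁, R, hρ₁pos, by linarith, hΨinf, hΨb, hLc, hLe, hLb,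
    hΨ'inf, hΨ'b, hL'c, hL'e, hL'b,
    flat_of_subset hflat0' (ball_subset_ball (by linarith)) rfl,
    flat_of_subset hflat1' (ball_subset_ball (by linarith)) rfl, ?_, ?_⟩
  · -- the floor points `s = a₀ + t`, `0 < t < ρ₁`
    intro t ht htρ
    have ht2 : |t| < 2 * ρ₀ := by rw [abs_of_pos ht]; linarith
    obtain ⟨q, hq0, hQq, hqt⟩ := hQt t ht.ne' ht2
    -- flatness at `s` with radius `t/2`
    have hims : (a₀ + (t : ℂ)).im = a₀.im := by simp
    have hdt : dist (a₀ + (t : ℂ)) a₀ = t := by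
      rw [dist_eq_norm, add_sub_cancel_left, norm_real, Real.norm_eq_abs, abs_of_pos ht]
    have hballs : ball (a₀ + (t : ℂ)) (t / 2) ⊆ ball a₀ (2 * ρ₀) := by
      intro z hz
      rw [mem_ball] at hz ⊢
      calc dist z a₀ ≤ dist z (a₀ + t) + dist (a₀ + (t : ℂ)) a₀ := dist_triangle _ _ _
        _ < t / 2 + t := add_lt_add_of_lt_of_le hz hdt.le
        _ ≤ 2 * ρ₀ := by linarith
    have hflats : D.carrier ∩ ball (a₀ + t) (t / 2) = {z : ℂ | (a₀ + (t : ℂ)).im < z.im} ∩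
        ball (a₀ + t) (t / 2) := flat_of_subset hflat0 (hballs.trans (ball_subset_ball hρ₀ρ)) hims
    have hflats' : D'.carrier ∩ ball (a₀ + t) (t / 2) = {z : ℂ | (a₀ + (t : ℂ)).im < z.im} ∩
        ball (a₀ + t) (t / 2) := flat_of_subset hflat0' hballs hims
    -- real boundary values along the diameter of `B(s, t/2)` (which avoids `a₀`)
    have hdiam : ∀ t' : ℝ, |t'| < t / 2 → a₀ + t + t' = a₀ + ((t + t' : ℝ) : ℂ) ∧
        (t + t' ≠ 0) ∧ |t + t'| < 2 * ρ₀ := by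
      intro t' ht'
      obtain ⟨h1, h2⟩ := abs_lt.1 ht'
      exact ⟨by push_cast; ring, by linarith, abs_lt.2 ⟨by linarith, by linarith⟩⟩
    have hbvs : ∀ t' : ℝ, |t'| < t / 2 → ∃ σ : ℝ, Tendsto Ψ (𝓝[D.carrier] (a₀ + t + t')) (𝓝 (σ : ℂ)) := by
      intro t' ht'
      obtain ⟨he, hne0, hlt⟩ := hdiam t' ht'
      exact he ▸ hΨreal _ (hfr _ hlt) (hne_a _ hne0)
    have hbvs' : ∀ t' : ℝ, |t'| < t / 2 →
        ∃ σ : ℝ, Tendsto Ψ' (𝓝[D'.carrier] (a₀ + t + t')) (𝓝 (σ : ℂ)) := by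
      intro t' ht'
      obtain ⟨he, hne0, hlt⟩ := hdiam t' ht'
      exact he ▸ hΨ'real _ (hfr' _ hlt) (hne_a _ hne0)
    obtain ⟨Ls, hLs⟩ := exists_tendsto_log_deriv_of_flat Ψ (half_pos ht) hflats hbvs hLc hLe
    obtain ⟨L's, hL's⟩ := exists_tendsto_log_deriv_of_flat Ψ' (half_pos ht) hflats' hbvs' hL'c hL'e
    refine ⟨hfr t ht2, hfr' t ht2, hne_a t ht.ne', Ls, L's, hLs, hL's, ?_⟩
    -- `exp (L's - Ls) = N (Q t)`
    have hqgood := hgood (q : ℂ) (by exact_mod_cast hq0) (by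
      rw [← hQq]; exact ht₀Q t ht (htρ.trans_le hρ₁t₀))
    have hs1 : exp (L's - Ls) = deriv (hullExt Φ) q * (q : ℂ) ^ 2 / hullExt Φ q ^ 2 := by
      refine exp_sub_eq_of_tendsto hsub (frontier_subset_closure (hfr' t ht2)) hLs hL's ?_ hkey
      have h1 : Tendsto φ.symm (𝓝[D'.carrier] (a₀ + t)) (𝓝 (q : ℂ)) :=
        hqt.mono_left (nhdsWithin_mono _ hsub)
      exact (continuousAt_derivRatio hB hΦ hqgood.1 hqgood.2).tendsto.comp h1
    -- real parts
    have hre1 : (L'b - Lb).re = 0 := by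
      have := congrArg (fun w => Real.log ‖w‖) hb1
      simpa [Complex.norm_exp] using this
    have hre2 : (L's - Ls).re = Real.log ‖deriv (hullExt Φ) q * (q : ℂ) ^ 2 / hullExt Φ q ^ 2‖ := by
      rw [← hs1, Complex.norm_exp, Real.log_exp]
    rw [hR]
    simp only
    rw [hQq]
    congr 1
    have : (Ls - Lb).re - (L's - L'b).re = (L'b - Lb).re - (L's - Ls).re := by
      simp only [sub_re]; ring
    rw [this, hre1, hre2]
    ring
  · -- coalescence: `R t → d^{5/8}`
    have hQne : Tendsto Q (𝓝[>] 0) (𝓝[≠] 0) := by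
      refine tendsto_nhdsWithin_iff.2 ⟨hQ0, ?_⟩
      have hev : ∀ᶠ t : ℝ in 𝓝[>] 0, t < 2 * ρ₀ :=
        mem_nhdsWithin_of_mem_nhds (Iio_mem_nhds (by linarith))
      filter_upwards [hev, self_mem_nhdsWithin] with t ht ht0
      have ht0' : 0 < t := ht0
      obtain ⟨q, hq0, hQq, -⟩ := hQt t ht0'.ne' (by rw [abs_of_pos ht0']; exact ht)
      rw [hQq]
      show (q : ℂ) ≠ 0
      exact_mod_cast hq0
    have hN : Tendsto (fun t => deriv (hullExt Φ) (Q t) * (Q t) ^ 2 / hullExt Φ (Q t) ^ 2)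
        (𝓝[>] 0) (𝓝 ((d : ℂ)⁻¹)) := (tendsto_derivRatio_zero hA hΦ hd hd0).comp hQne
    have hnorm : Tendsto (fun t => ‖deriv (hullExt Φ) (Q t) * (Q t) ^ 2 / hullExt Φ (Q t) ^ 2‖)
        (𝓝[>] 0) (𝓝 d⁻¹) := by
      have := (continuous_norm.tendsto _).comp hN
      rwa [norm_inv, norm_real, Real.norm_of_nonneg hd0.le] at this
    have hlog := (Real.continuousAt_log (inv_ne_zero hd0.ne')).tendsto.comp hnorm
    rw [Function.comp_def, Real.log_inv] at hlog
    have hexp := (Real.continuous_exp.tendsto _).comp ((hlog.neg).const_mul (5 / 8))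
    rw [neg_neg] at hexp
    have hval : Real.exp ((5 / 8) * Real.log d) = d ^ ((5 : ℝ) / 8) := by
      rw [Real.rpow_def_of_pos hd0, mul_comm]
    rw [hval] at hexp
    exact hexp

/-! ### Registered form (sub-goal of `stub_restrictionCocycle`) -/

/-- **Registered sub-goal `stub_restrictionCocycle_flatFrontier`** (crux item
stmt-CriticalPhenomena-10472, line `floor-ratio-restriction-bootstrap`, mechanism stub
`stub_restrictionCocycle`): the diameter of a flat half-disc consists of frontier points
(`mem_frontier_of_flat`). [folklore] -/
theorem stub_restrictionCocycle_flatFrontier : ∀ (S : Set ℂ) (x : ℂ) (ρ : ℝ),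
    S ∩ ball x ρ = {z : ℂ | x.im < z.im} ∩ ball x ρ → ∀ (t : ℝ), |t| < ρ → x + t ∈ frontier S :=
  fun _ _ _ hflat _ ht => mem_frontier_of_flat hflat ht

end Summit.CriticalPhenomena.SAWScalingLimit.Theorems.ObservableToSLE.FloorRatio

end
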